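import Mathlib
import Summits.KontsevichZagierPeriods.Zeta5Search.RayAtlasCellsX
import HarnessLib

/-!
# ζ(5) search — the split of `RayAtlas.X1CellQ` at the affine moment range `θ = 50/7` (HONEST FRAMING: systematic search; no irrationality claim unless certified)

Cell `pub-zeta5`, GEN-2 seat generation 19 (acting on P1 g8's note `pub-zeta5-p1/X1CellQ-note-g8.md`, "planner's call").  The X1 cell Q of
gen-2 g9's near-miss atlas (`RayAtlasCellsX.X1CellQ`: ray `bX1Ray n = n·(61; 22,…,16)`, primes `7n < p < 43n/6`, bound `−26 = casLB + 1`,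
AFFINE kind) is the one cell of the X/Row/record affine atlas that P1's machine does not prove as typed: the collinearity criterion's moment
range `(N−1)p + 2 ≤ 2·dOf + 3` with `N = 15`, `dOf = 50n` reads `14p ≤ 100n + 1`, i.e. `θ ≤ 50/7 ≈ 7.1429`, while the typed cell extends to
`43/6 ≈ 7.1667`.  This file splits the cell there:

* `X1CellQMain` (`7n < p`, `7p ≤ 50n`): affine-formal on all 772 instances with `n ≤ 150` (two orbit keys, ONE witness class `x = 19n − 2p`;
  P1 g8 `affcell.py`, re-run by gen-2 g19) — proved by the atlas machine (`Atlas/X1CellQMain*.lean`, gen-2 g19);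
* `X1CellQSliver` (`50n < 7p`, `6p < 43n`): OPEN second-digit target — both orbit keys `(1,1,−5,−6,−6,−2,1,1)`, `(1,1,−4,−6,−6,−3,1,1)` occur
  in every one of its 128 instances with `n ≤ 150` (none below `n = 42`), so neither the through-origin case nor the moment range applies, and
  the zero-regime law's degree budget `p(M−2) ≤ 2d + 1` (`M = 16`) is the same inequality; the bound is nevertheless expected (`casLB + 1`;
  gen-2's exact ladder gives `−26` at the excluded endpoint `(n, p) = (6, 43)`).

Only the split and its exactness are proved here.  `p`-adic bookkeeping of rational numbers; nothing here bears on irrationality.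
-/

noncomputable section

namespace Summit.KontsevichZagierPeriods.Zeta5Search.RayAtlas

open Summit.KontsevichZagierPeriods.Zeta5Search.CasoratianValuation (casoratian)

/-- **X1CellQMain** (`θ = p/n ∈ (7, 50/7]`, affine, casLB −27, inside the moment range): `v_p(Cas₇) ≥ −26`. -/
@[conjecture] def X1CellQMain : Prop :=
  ∀ n p : ℕ, 2 ≤ n → p.Prime → 61 * n + 2 < p * p → 7 * n < p → 7 * p ≤ 50 * n → casoratian (bX1Ray n) 7 ≠ 0 →
    (-26 : ℤ) ≤ padicValRat p (casoratian (bX1Ray n) 7)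

/-- **X1CellQSliver** (`θ = p/n ∈ (50/7, 43/6)`, casLB −27, OUTSIDE the moment range; mechanism open): `v_p(Cas₇) ≥ −26`. -/
@[conjecture] def X1CellQSliver : Prop :=
  ∀ n p : ℕ, 2 ≤ n → p.Prime → 61 * n + 2 < p * p → 50 * n < 7 * p → 6 * p < 43 * n → casoratian (bX1Ray n) 7 ≠ 0 →
    (-26 : ℤ) ≤ padicValRat p (casoratian (bX1Ray n) 7)

/-- **The split**: `X1CellQ` follows from its main part and its sliver. -/
theorem x1CellQ_of_split (hM : X1CellQMain) (hS : X1CellQSliver) : X1CellQ := by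
  intro n p hn hp hw h1 h2 hne
  rcases Nat.lt_or_ge (50 * n) (7 * p) with hlt | hge
  · exact hS n p hn hp hw hlt h2 hne
  · exact hM n p hn hp hw h1 hge hne

/-- Converse, main part: a restriction of `X1CellQ` (`7p ≤ 50n` gives `6p < 43n`). -/
theorem x1CellQMain_of (h : X1CellQ) : X1CellQMain :=
  fun n p hn hp hw h1 h2 hne => h n p hn hp hw h1 (by omega) hne

/-- Converse, sliver: a restriction of `X1CellQ` (`50n < 7p` gives `7n < p`), so the split is exact. -/
theorem x1CellQSliver_of (h : X1CellQ) : X1CellQSliver :=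
  fun n p hn hp hw h1 h2 hne => h n p hn hp hw (by omega) h2 hne

end Summit.KontsevichZagierPeriods.Zeta5Search.RayAtlas

end
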